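import Summits.CriticalPhenomena.SAWScalingLimit.Theorems.SimpleSubseqLimits.Negative.SimpleSubseqLimitsHonesty
import Summits.CriticalPhenomena.SAWScalingLimit.Theorems.SimpleSubseqLimits.Negative.SimpleSubseqLimitsNecessary
import Literature.Probability.RandomPlanarGeometry.SimpleCurves

/-!
# drefute stmt-CriticalPhenomena-4982 / line `marked-point-revisit` — the lattice input
`OnePointNoTouch` (stub 5, hardest) is NOT over-strong: it is implied by the summit conjunct

`theorem onePointNoTouch_of_sawScalingLimit : SAWScalingLimit → OnePointNoTouch` (defs
`MarkedConfig`, `RevisitNear`, `latticeCurve`, `OnePointNoTouch` verbatim from the skeleton, same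
namespace). Proof = the planner's paper argument, kernel-checked: portmanteau for the CLOSED
enlargements `revisitClass z ρ R ε = closure (mk '' {RevisitNear · z ρ R ε})` along `𝓝[>] 0`
(`FiniteMeasure.limsup_measure_closed_le_of_tendsto`), continuity from above, and the deterministic
core `not_mem_revisitClass_forall_of_simple`: a simple class in every `revisitClass z ρ R (1/(n+1))`
would carry, in the uniform limit of reparametrised near-revisiting curves (compactness of
`I × I × I`), a configuration `lam ≤ T ≤ t'` with `η lam ∈ sphere z R`, `η T ∈ closedBall z ρ`,
`η t' = η lam`; injectivity forces `lam = T`, contradicting `ρ < R`.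
So stub 5 cannot be false unless the summit conjunct (LSW Prediction 1 as typed) is.
-/

noncomputable section

open MeasureTheory Filter Topology Set Metric
open Literature.Probability.RandomPlanarGeometry Literature.Probability.LatticeModels
open scoped ENNReal NNReal BoundedContinuousFunction unitInterval

namespace Summit.CriticalPhenomena.SAWScalingLimit.Cruxes.SimpleSubseqLimits.MarkedPointRevisit

open Summit.CriticalPhenomena.SAWScalingLimit.Theorems.SimpleSubseqLimits.Negative
  (ae_carrier_of_isSLELaw)

/-- verbatim from the skeleton -/
def MarkedConfig (γ : Curve ℂ) (z : ℂ) (ρ R : ℝ) (lam T : I) : Prop :=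
  lam < T ∧ γ lam ∈ sphere z R ∧ (∀ u : I, lam ≤ u → u ≤ T → γ u ∈ closedBall z R) ∧
    γ T ∈ closedBall z ρ ∧ ∀ u : I, u < T → γ u ∉ closedBall z ρ

/-- verbatim from the skeleton -/
def RevisitNear (γ : Curve ℂ) (z : ℂ) (ρ R ε : ℝ) : Prop :=
  ∃ lam T t' : I, MarkedConfig γ z ρ R lam T ∧ T < t' ∧ dist (γ t') (γ lam) ≤ ε

/-- verbatim from the skeleton -/
def latticeCurve {Ω : Set ℂ} {δ : ℝ} {u v : Site 2} (γ : SAW.DomainSAW Ω δ u v) : Curve ℂ :=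
  ⟨γ.walk.toCurve (meshPoint δ)⟩

theorem mk_latticeCurve {Ω : Set ℂ} {δ : ℝ} {u v : Site 2} (γ : SAW.DomainSAW Ω δ u v) :
    CurveClass.mk (latticeCurve γ) = γ.curve := rfl

/-- verbatim from the skeleton -/
def OnePointNoTouch : Prop :=
  ∀ (D : DobrushinDomain) (a b : ℝ → Site 2), SAW.IsEndpointApprox D a b →
    ∀ (z : ℂ) (ρ R : ℝ), 0 < ρ → ρ < R → ∀ θ : ℝ≥0∞, 0 < θ →
      ∃ ε : ℝ, 0 < ε ∧
        limsup (fun δ : ℝ => SAW.law D.carrier δ (a δ) (b δ)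
            {γ | RevisitNear (latticeCurve γ) z ρ R ε}) (𝓝[>] (0 : ℝ)) ≤ θ

/-! ## Reparametrisation invariance and monotonicity of the event -/

theorem revisitNear_reparam {γ : Curve ℂ} {z : ℂ} {ρ R ε : ℝ} (h : RevisitNear γ z ρ R ε)
    (φ : I ≃o I) : RevisitNear (γ.reparam φ) z ρ R ε := by
  obtain ⟨lam, T, t', ⟨hlt, hsph, hin, hT, hfirst⟩, hTt, hd⟩ := h
  refine ⟨φ.symm lam, φ.symm T, φ.symm t', ⟨?_, ?_, ?_, ?_, ?_⟩, ?_, ?_⟩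
  · exact φ.symm.lt_iff_lt.2 hlt
  · show γ (φ (φ.symm lam)) ∈ _; rw [φ.apply_symm_apply]; exact hsph
  · intro u h1 h2
    show γ (φ u) ∈ _
    refine hin (φ u) ?_ ?_
    · simpa using φ.monotone h1
    · simpa using φ.monotone h2
  · show γ (φ (φ.symm T)) ∈ _; rw [φ.apply_symm_apply]; exact hT
  · intro u hu
    show γ (φ u) ∉ _
    exact hfirst (φ u) (by simpa using φ.strictMono hu)
  · exact φ.symm.lt_iff_lt.2 hTt
  · show dist (γ (φ (φ.symm t'))) (γ (φ (φ.symm lam))) ≤ ε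
    rw [φ.apply_symm_apply, φ.apply_symm_apply]; exact hd

theorem revisitNear_mono {γ : Curve ℂ} {z : ℂ} {ρ R ε ε' : ℝ} (h : RevisitNear γ z ρ R ε)
    (hε : ε ≤ ε') : RevisitNear γ z ρ R ε' := by
  obtain ⟨lam, T, t', hmk, hTt, hd⟩ := h
  exact ⟨lam, T, t', hmk, hTt, hd.trans hε⟩

/-! ## The closed enlargements -/

/-- The closed event "some curve of the class `ε`-nearly revisits a marked point", closed up. -/
def revisitClass (z : ℂ) (ρ R ε : ℝ) : Set (CurveClass ℂ) :=
  closure (CurveClass.mk '' {γ : Curve ℂ | RevisitNear γ z ρ R ε})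

theorem isClosed_revisitClass (z : ℂ) (ρ R ε : ℝ) : IsClosed (revisitClass z ρ R ε) :=
  isClosed_closure

theorem revisitClass_mono (z : ℂ) (ρ R : ℝ) {ε ε' : ℝ} (hε : ε ≤ ε') :
    revisitClass z ρ R ε ⊆ revisitClass z ρ R ε' :=
  closure_mono (image_mono fun _ h => revisitNear_mono h hε)

theorem mk_mem_revisitClass {γ : Curve ℂ} {z : ℂ} {ρ R ε : ℝ} (h : RevisitNear γ z ρ R ε) :
    CurveClass.mk γ ∈ revisitClass z ρ R ε :=
  subset_closure ⟨γ, h, rfl⟩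

/-- A class in `revisitClass z ρ R ε` has, for every `η` representing it and every `c > 0`, a curve
UNIFORMLY `(something < c)`-close to `η` which `ε`-nearly revisits a marked point. -/
theorem exists_near_of_mem_revisitClass {η : Curve ℂ} {z : ℂ} {ρ R ε : ℝ}
    (h : CurveClass.mk η ∈ revisitClass z ρ R ε) {c : ℝ} (hc : 0 < c) :
    ∃ γ : Curve ℂ, RevisitNear γ z ρ R ε ∧ ∀ t, dist (η t) (γ t) < c := by
  obtain ⟨b, ⟨γ, hγ, rfl⟩, hd⟩ := Metric.mem_closure_iff.1 h c hc
  change dist (SeparationQuotient.mk η) (SeparationQuotient.mk γ) < c at hd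
  rw [SeparationQuotient.dist_mk] at hd
  obtain ⟨φ, hφ⟩ := Curve.exists_dist_reparam_lt hd
  refine ⟨γ.reparam φ, revisitNear_reparam hγ φ, fun t => ?_⟩
  exact (ContinuousMap.dist_apply_le_dist t).trans_lt hφ

/-- **Deterministic core.** A simple class lies in `revisitClass z ρ R (1/(n+1))` for every `n`
only if `R ≤ ρ`. -/
theorem not_mem_revisitClass_forall_of_simple {z : ℂ} {ρ R : ℝ} (hρR : ρ < R) {c : CurveClass ℂ}
    (hc : c ∈ CurveClass.simple) (h : ∀ n : ℕ, c ∈ revisitClass z ρ R (1 / ((n : ℝ) + 1))) :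
    False := by
  obtain ⟨η, hη, rfl⟩ := hc
  -- near-revisiting curves uniformly close to `η`
  have hex : ∀ n : ℕ, ∃ γ : Curve ℂ, RevisitNear γ z ρ R (1 / ((n : ℝ) + 1)) ∧
      ∀ t, dist (η t) (γ t) < 1 / ((n : ℝ) + 1) := fun n =>
    exists_near_of_mem_revisitClass (h n) (by positivity)
  choose γ hγ hclose using hex
  choose lam T t' hmk hTt hdist using hγ
  -- a convergent subsequence of the configurations
  obtain ⟨⟨lam₀, T₀, t₀⟩, ψ, hψ, hlim⟩ :=
    CompactSpace.tendsto_subseq (fun n => (lam n, T n, t' n))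
  have hlam : Tendsto (fun k => lam (ψ k)) atTop (𝓝 lam₀) :=
    (continuous_fst.tendsto _).comp hlim
  have hT : Tendsto (fun k => T (ψ k)) atTop (𝓝 T₀) :=
    (continuous_fst.comp continuous_snd).tendsto _ |>.comp hlim
  have ht : Tendsto (fun k => t' (ψ k)) atTop (𝓝 t₀) :=
    (continuous_snd.comp continuous_snd).tendsto _ |>.comp hlim
  -- the error sequence
  have herr : Tendsto (fun k : ℕ => 1 / ((ψ k : ℝ) + 1)) atTop (𝓝 0) := by
    have h1 : Tendsto (fun k : ℕ => 1 / ((k : ℝ) + 1)) atTop (𝓝 0) :=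
      tendsto_one_div_add_atTop_nhds_zero_nat
    refine squeeze_zero (fun k => by positivity) (fun k => ?_) h1
    have : (k : ℝ) ≤ ψ k := by exact_mod_cast hψ.id_le k
    exact one_div_le_one_div_of_le (by positivity) (by linarith)
  -- uniform convergence + continuity: values along moving times converge
  have hval : ∀ {u : ℕ → I} {u₀ : I}, Tendsto (fun k => u (ψ k)) atTop (𝓝 u₀) →
      Tendsto (fun k => γ (ψ k) (u (ψ k))) atTop (𝓝 (η u₀)) := by
    intro u u₀ hu
    rw [tendsto_iff_dist_tendsto_zero]
    have h2 : Tendsto (fun k => dist (η (u (ψ k))) (η u₀)) atTop (𝓝 0) := by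
      rw [← tendsto_iff_dist_tendsto_zero]
      exact (η.continuous.tendsto u₀).comp hu
    refine squeeze_zero (fun k => dist_nonneg) (fun k => ?_)
      (by simpa only [add_zero] using herr.add h2)
    calc dist (γ (ψ k) (u (ψ k))) (η u₀)
        ≤ dist (γ (ψ k) (u (ψ k))) (η (u (ψ k))) + dist (η (u (ψ k))) (η u₀) := dist_triangle _ _ _
      _ ≤ 1 / ((ψ k : ℝ) + 1) + dist (η (u (ψ k))) (η u₀) := by
          gcongr; rw [dist_comm]; exact (hclose (ψ k) _).le
  have hvlam := hval hlam
  have hvT := hval hT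
  have hvt := hval ht
  -- (a) `η lam₀ ∈ sphere z R`
  have ha : dist (η lam₀) z = R := by
    have h1 : Tendsto (fun k => dist (γ (ψ k) (lam (ψ k))) z) atTop (𝓝 (dist (η lam₀) z)) :=
      hvlam.dist tendsto_const_nhds
    have h2 : ∀ k, dist (γ (ψ k) (lam (ψ k))) z = R := fun k => (hmk (ψ k)).2.1
    exact tendsto_nhds_unique h1 (by simp_rw [h2]; exact tendsto_const_nhds)
  -- (b) `η T₀ ∈ closedBall z ρ`
  have hb : dist (η T₀) z ≤ ρ := by
    have h1 : Tendsto (fun k => dist (γ (ψ k) (T (ψ k))) z) atTop (𝓝 (dist (η T₀) z)) :=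
      hvT.dist tendsto_const_nhds
    exact le_of_tendsto' h1 fun k => (hmk (ψ k)).2.2.2.1
  -- (c) `η t₀ = η lam₀`
  have hc' : η t₀ = η lam₀ := by
    have h1 : Tendsto (fun k => dist (γ (ψ k) (t' (ψ k))) (γ (ψ k) (lam (ψ k)))) atTop
        (𝓝 (dist (η t₀) (η lam₀))) := hvt.dist hvlam
    have h2 : Tendsto (fun k => dist (γ (ψ k) (t' (ψ k))) (γ (ψ k) (lam (ψ k)))) atTop (𝓝 0) :=
      squeeze_zero (fun k => dist_nonneg) (fun k => hdist (ψ k)) herr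
    exact dist_eq_zero.1 (tendsto_nhds_unique h1 h2)
  -- (d) order of the limit times
  have hd1 : lam₀ ≤ T₀ := le_of_tendsto_of_tendsto' hlam hT fun k => (hmk (ψ k)).1.le
  have hd2 : T₀ ≤ t₀ := le_of_tendsto_of_tendsto' hT ht fun k => (hTt (ψ k)).le
  -- (e) contradiction
  have he : t₀ = lam₀ := hη hc'
  have hTeq : T₀ = lam₀ := le_antisymm (he ▸ hd2) hd1
  rw [hTeq, ha] at hb
  exact absurd hb (not_le.2 hρR)

/-- Under an SLE_(8/3) law the closed enlargements have vanishing mass as `ε = 1/(n+1) → 0`. -/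
theorem tendsto_measure_revisitClass {D : DobrushinDomain} {μ : Measure (CurveClass ℂ)}
    (hμ : IsSLELaw ((8 : ℝ≥0) / 3) D μ) [IsFiniteMeasure μ] (z : ℂ) {ρ R : ℝ} (hρR : ρ < R) :
    Tendsto (fun n : ℕ => μ (revisitClass z ρ R (1 / ((n : ℝ) + 1)))) atTop (𝓝 0) := by
  have hanti : Antitone fun n : ℕ => revisitClass z ρ R (1 / ((n : ℝ) + 1)) := by
    intro m n hmn
    have hmn' : (m : ℝ) ≤ n := by exact_mod_cast hmn
    exact revisitClass_mono z ρ R (one_div_le_one_div_of_le (by positivity) (by linarith))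
  have hlim := tendsto_measure_iInter_atTop (μ := μ)
    (fun n : ℕ => (isClosed_revisitClass z ρ R (1 / ((n : ℝ) + 1))).measurableSet.nullMeasurableSet)
    hanti ⟨0, measure_ne_top μ _⟩
  have h0 : μ (⋂ n : ℕ, revisitClass z ρ R (1 / ((n : ℝ) + 1))) = 0 := by
    have hae := ae_carrier_of_isSLELaw hμ
    rw [ae_iff] at hae
    refine measure_mono_null (fun c hc => ?_) hae
    intro hcar
    exact not_mem_revisitClass_forall_of_simple hρR hcar.1 (mem_iInter.1 hc)
  rw [h0] at hlim
  exact hlim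

/-- **Stub 5 is implied by the summit conjunct.** -/
theorem onePointNoTouch_of_sawScalingLimit (hS : _root_.SAWScalingLimit) : OnePointNoTouch := by
  intro D a b hab z ρ R _hρ hρR θ hθ
  obtain ⟨Γ, hΓ, -, hT⟩ := hS D a b hab
  haveI : Fact Literature.Probability.Process.isProjectiveLimit_preWienerMeasure :=
    ⟨isProjectiveLimit_preWienerMeasure_holds⟩
  set μ : Measure (CurveClass ℂ) := Literature.Probability.Process.preWienerMeasure.map Γ with hμdef
  have hμ : IsSLELaw ((8 : ℝ≥0) / 3) D μ := ⟨Γ, hΓ, rfl⟩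
  haveI := hμ.isProbabilityMeasure
  -- choose `ε = 1/(n+1)` with `μ (revisitClass …) < θ`
  obtain ⟨n, hn⟩ := ((tendsto_order.1 (tendsto_measure_revisitClass hμ z hρR)).2 θ hθ).exists
  refine ⟨1 / ((n : ℝ) + 1), by positivity, ?_⟩
  set F : Set (CurveClass ℂ) := revisitClass z ρ R (1 / ((n : ℝ) + 1)) with hF
  have hFc : IsClosed F := isClosed_revisitClass _ _ _ _
  -- the pushed-forward laws as finite measures, converging along `𝓝[>] 0`
  let μs : ℝ → FiniteMeasure (CurveClass ℂ) := fun δ =>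
    ⟨(SAW.law D.carrier δ (a δ) (b δ)).map (fun γ => γ.curve), inferInstance⟩
  let μf : FiniteMeasure (CurveClass ℂ) := ⟨μ, inferInstance⟩
  have hlim : Tendsto μs (𝓝[>] (0 : ℝ)) (𝓝 μf) := by
    rw [FiniteMeasure.tendsto_iff_forall_integral_tendsto]
    intro f
    have h1 := hT f
    rw [← integral_map hΓ.aemeasurable f.continuous.aestronglyMeasurable] at h1
    refine h1.congr fun δ => ?_
    change _ = ∫ x, f x ∂((SAW.law D.carrier δ (a δ) (b δ)).map (fun γ => γ.curve))
    rw [integral_map (SAW.DomainSAW.measurable_of_top _).aemeasurable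
      f.continuous.aestronglyMeasurable]
  have hport := FiniteMeasure.limsup_measure_closed_le_of_tendsto hlim hFc
  -- compare the lattice event with the closed class event
  have hle : ∀ δ : ℝ, SAW.law D.carrier δ (a δ) (b δ) {γ | RevisitNear (latticeCurve γ) z ρ R
      (1 / ((n : ℝ) + 1))} ≤ ((μs δ : FiniteMeasure (CurveClass ℂ)) : Measure (CurveClass ℂ)) F := by
    intro δ
    change _ ≤ ((SAW.law D.carrier δ (a δ) (b δ)).map (fun γ => γ.curve)) F
    rw [Measure.map_apply (SAW.DomainSAW.measurable_of_top _) hFc.measurableSet]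
    refine measure_mono fun γ hγ => ?_
    show γ.curve ∈ F
    rw [← mk_latticeCurve]
    exact mk_mem_revisitClass hγ
  calc limsup (fun δ : ℝ => SAW.law D.carrier δ (a δ) (b δ)
          {γ | RevisitNear (latticeCurve γ) z ρ R (1 / ((n : ℝ) + 1))}) (𝓝[>] (0 : ℝ))
      ≤ limsup (fun δ => ((μs δ : FiniteMeasure (CurveClass ℂ)) : Measure (CurveClass ℂ)) F)
          (𝓝[>] (0 : ℝ)) := limsup_le_limsup (Eventually.of_forall hle)
    _ ≤ (μf : Measure (CurveClass ℂ)) F := hport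
    _ ≤ θ := hn.le

end Summit.CriticalPhenomena.SAWScalingLimit.Cruxes.SimpleSubseqLimits.MarkedPointRevisit

end
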